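import Summits.NavierStokesRegularity.NavierStokesRegularity.Theses.TypeICertificateLadder
import Literature.Analysis.FluidPDE.SereginSverakPressureLocalTypeI
import Literature.Analysis.FluidPDE.NSCriticalClosureBesovKatoClass

/-!
# Route TypeICertificateLadder — crux `NoTypeIBlowup` (item stmt-NavierStokesRegularity-1217):
# reduction to Albritton–Barker's local Type I singular points, given the scaled energy bound

`NoTypeIBlowup` (no Type I blow-up for Clay data) is symmetry-free Type I exclusion, an OPEN
problem. This file PROVES, sorry-free, the second structural reduction of the crux:

  `ScaledEnergyBound → ¬ LocalTypeISingularityExists → NoTypeIBlowup`,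

where `ScaledEnergyBound` is the route's own support item stmt-NavierStokesRegularity-2884 (a
Morrey-type bound `r⁻¹ ∫_{B_r(x₀)} |u(t)|² ≤ A ν²` near the blow-up time for solutions with the
Type I rate — Barker–Prange 2020, (e.typeI); Seregin–Šverák 2009, Lemma 3.5) and
`LocalTypeISingularityExists` is the registered OPEN statement of `LocalTypeI.lean` (first bullet
of Albritton–Barker 2019, Thm. 1.1: some suitable weak solution has a Type I singular point with
`𝐈 = sup_{Q'} (A + C + D + E) < ∞`), which is FALSE under the Liouville conjecture (L) of
Koch–Nadirashvili–Seregin–Šverák 2009 by the Albritton–Barker characterisation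
(`AlbrittonBarkerForward` with `LiouvilleConjectureNS.not_nontrivialMildAncientTypeIExists_measurable`).

The argument is the tree's `SereginSverak2002.exists_zoom_typeIBound_lt_top`
(`SereginSverakPressureLocalTypeI.lean`, where the Morrey bound comes from a one-sided pressure
bound) with its Step 1 replaced by the Morrey hypothesis: the viscosity-normalising parabolic zoom
`v = α u ∘ Φ`, `π = α² q ∘ Φ` about a final-time point `(T, x₀)` (`q` Tao's gauge of the pressure)
is a suitable weak solution of the unit-viscosity system in `Q(0, 1)` in the class of
Albritton–Barker Def. 2.1 with `𝐈(Q(0, 1/2)) < ∞` — the scaled energies `A` on all parabolic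
sub-balls are bounded by the Morrey hypothesis transported along `Φ`, and the tree's
`albrittonBarker2019_lemma_2_6_holds` (Seregin 2006) bounds `C, D, E`. If `u` were unbounded on
every backward cylinder at `(T, x₀)`, the origin would be a local Type I singular point of the
zoom; otherwise every `(T, x₀)` carries a bounded backward cylinder and Lemarié-Rieusset's
Thm. 15.1 (C) (`hasSmoothExtensionPast_of_forall_exists_parabolicCylinder`) continues `u` past `T`.

Contents:
* `exists_zoom_typeIBound_lt_top_of_morrey` — the zoom is locally Type I under a Morrey bound;
* `isBackwardBoundedAt_of_morrey_of_not_localTypeISingularityExists` — hence, if no local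
  Type I singular point exists, `u` is bounded on a backward cylinder at every `(T, x₀)`;
* `eventually_morrey_of_scaledEnergyBound` — item 2884 + `IsTypeIBlowup` give the Morrey bound;
* `noTypeIBlowup_of_scaledEnergyBound_of_not_localTypeISingularityExists` — the reduction.

All theorems are CONDITIONAL on their displayed hypotheses; nothing here closes item 1217.
-/

noncomputable section

namespace Summit.NavierStokesRegularity.NavierStokesRegularity.Theorems

open Set Filter Topology MeasureTheory
open InnerProductSpace Function TopologicalSpace Metric
open Literature.Analysis.FluidPDE
open scoped ContDiff RealInnerProductSpace ENNReal NNReal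

section Zoom

variable {ν T : ℝ} {u : ℝ → EuclideanSpace ℝ (Fin 3) → EuclideanSpace ℝ (Fin 3)}
  {p : ℝ → EuclideanSpace ℝ (Fin 3) → ℝ}

/-- **The viscosity-normalising zoom about a final-time point is locally Type I under a Morrey
bound.** For a classical solution on `[0, T)` (viscosity `ν > 0`), Leray–Hopf on `[0, T)`, whose
scaled local energies satisfy `∫_{B(x₁, r)} |u(t)|² ≤ M r` for all centres `x₁`, all radii
`0 < r ≤ r₀` and all `t` in a final interval `(T₁, T)` (the Morrey-type Type I condition (e.typeI)
of Barker–Prange 2020; Seregin–Šverák 2009, Lemma 3.5), and any `x₀`, there are `R, α, β > 0`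
such that, with the gauged pressure `q = p − c(t)` and `Φ(s, y) = (T + βs, x₀ + Ry)`, the pair
`v = α u ∘ Φ`, `π = α² q ∘ Φ` is a suitable weak solution of the unit-viscosity system in the
parabolic ball `Q(0, 1)` (Albritton–Barker Def. 2.1) whose Type I quantity on `Q(0, 1/2)` is
finite, `𝐈(Q(0, 1/2)) < ⊤`: the scaled energies `A` are bounded on all parabolic sub-balls by the
hypothesis, and `C, D, E` by `albrittonBarker2019_lemma_2_6_holds` (Seregin 2006). The proof is
that of the tree's `SereginSverak2002.exists_zoom_typeIBound_lt_top` with its Step 1 replaced by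
the hypothesis `hMor`. [cite: AlbrittonBarker2019, Lemma 2.6 and Def. 2.1; BarkerPrange2020, (e.typeI)] -/
theorem exists_zoom_typeIBound_lt_top_of_morrey (hν : 0 < ν) (hT : 0 < T)
    (hsol : IsClassicalNSSolutionOn (Ico 0 T) ν 0 u p) (hLH : IsLerayHopfOn T ν 0 (u 0) u)
    {r₀ M₀ T₁ : ℝ} (hr₀ : 0 < r₀) (hT₁ : T₁ < T)
    (hMor : ∀ t ∈ Ioo T₁ T, ∀ (x₁ : EuclideanSpace ℝ (Fin 3)) (r : ℝ), 0 < r → r ≤ r₀ →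
      ∫ x in ball x₁ r, ‖u t x‖ ^ 2 ≤ M₀ * r)
    (x₀ : EuclideanSpace ℝ (Fin 3)) :
    ∃ R α β : ℝ, 0 < R ∧ 0 < α ∧ 0 < β ∧ β = R ^ 2 / ν ∧ α = R / ν ∧ β ≤ T ∧
      IsSuitableWeakSolutionInBall 1 0 (α • stPull β R T x₀ u)
        (α ^ 2 • stPull β R T x₀ fun t x => p t x - (p t 0 - normalisedPressure (u t) 0)) ∧
      HasWeakSpatialGradientOn (parabolicCylinderOpens 1 (0 : ℝ × EuclideanSpace ℝ (Fin 3)))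
        (α • stPull β R T x₀ u) ((α * R) • stPull β R T x₀ fun t x => fderiv ℝ (u t) x) ∧
      typeIBound (parabolicCylinder (1 / 2) (0 : ℝ × EuclideanSpace ℝ (Fin 3)))
        (α • stPull β R T x₀ u)
        (α ^ 2 • stPull β R T x₀ fun t x => p t x - (p t 0 - normalisedPressure (u t) 0))
        ((α * R) • stPull β R T x₀ fun t x => fderiv ℝ (u t) x) < ⊤ := by
  -- Step 1: the Morrey bound with a nonnegative constant on a final window inside `(0, T)`
  set M : ℝ := max M₀ 0 with hMdef
  have hM0 : 0 ≤ M := le_max_right _ _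
  set δ : ℝ := min (T - T₁) T with hδ
  have hδpos : 0 < δ := lt_min (sub_pos.2 hT₁) hT
  have hδT : δ ≤ T := min_le_right _ _
  have hδT₁ : δ ≤ T - T₁ := min_le_left _ _
  have hM : ∀ t ∈ Ioo (T - δ) T, ∀ (x₁ : EuclideanSpace ℝ (Fin 3)) (r : ℝ), 0 < r → r ≤ r₀ →
      ∫ x in ball x₁ r, ‖u t x‖ ^ 2 ≤ M * r := by
    intro t ht x₁ r hr hrr₀
    exact (hMor t ⟨by linarith [ht.1], ht.2⟩ x₁ r hr hrr₀).trans
      (mul_le_mul_of_nonneg_right (le_max_left _ _) hr.le)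
  -- scales: `R ≤ r₀`, `R² / ν ≤ δ`
  set R : ℝ := min r₀ (Real.sqrt (ν * δ)) with hR
  have hRpos : 0 < R := lt_min hr₀ (Real.sqrt_pos.2 (by positivity))
  have hRr₀ : R ≤ r₀ := min_le_left _ _
  set α : ℝ := R / ν with hα
  set β : ℝ := R ^ 2 / ν with hβdef
  have hαpos : 0 < α := by positivity
  have hβpos : 0 < β := by positivity
  have hβeq : β = α * R := by rw [hβdef, hα]; field_simp
  have hβδ : β ≤ δ := by
    have h1 : R ≤ Real.sqrt (ν * δ) := min_le_right _ _
    have h2 : R ^ 2 ≤ ν * δ := by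
      have := pow_le_pow_left₀ hRpos.le h1 2
      rwa [Real.sq_sqrt (by positivity)] at this
    rw [hβdef, div_le_iff₀ hν]; linarith
  have hβT : β ≤ T := hβδ.trans hδT
  refine ⟨R, α, β, hRpos, hαpos, hβpos, rfl, rfl, hβT, ?_⟩
  -- the gauged pressure
  set q : ℝ → EuclideanSpace ℝ (Fin 3) → ℝ := fun t x => p t x - (p t 0 - normalisedPressure (u t) 0)
    with hq
  -- the `ν`-cylinder `(T - β, T) × B(x₀, R)` inside the slab, and its preimage `Q(0,1)`
  set PO : Opens (ℝ × EuclideanSpace ℝ (Fin 3)) :=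
    ⟨Ioo (T - β) T ×ˢ ball x₀ R, isOpen_Ioo.prod isOpen_ball⟩ with hPO
  have hPOslab : (PO : Set (ℝ × EuclideanSpace ℝ (Fin 3))) ⊆
      Ioo 0 T ×ˢ (univ : Set (EuclideanSpace ℝ (Fin 3))) := by
    rintro ⟨t, x⟩ ⟨ht, -⟩
    exact ⟨⟨by linarith [ht.1], ht.2⟩, mem_univ _⟩
  have hpre1 : stPreimage β R T x₀ PO =
      parabolicCylinderOpens 1 (0 : ℝ × EuclideanSpace ℝ (Fin 3)) := by
    apply Opens.ext
    rw [coe_stPreimage]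
    have h := stAffine_preimage_cylinder_eq_parabolicCylinder hν hRpos T x₀ R
    rw [div_self hRpos.ne'] at h
    exact h
  -- suitability of the zoom on `Q(0,1)` with unit viscosity
  have hsuit1 : IsSuitableWeakSolutionOn
      (parabolicCylinderOpens 1 (0 : ℝ × EuclideanSpace ℝ (Fin 3))) 1 0
      (α • stPull β R T x₀ u) (α ^ 2 • stPull β R T x₀ q) := by
    have h0 := (SereginSverak2002.isSuitableWeakSolutionOn_gauge_of_classical hν hT hsol hLH PO
      hPOslab).stRescale hαpos hRpos hβeq T x₀
    have hvisc : α * ν / R = 1 := by rw [hα, div_mul_cancel₀ R hν.ne', div_self hRpos.ne']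
    have hforce : ((α ^ 2 * R) • stPull β R T x₀
        (0 : ℝ → EuclideanSpace ℝ (Fin 3) → EuclideanSpace ℝ (Fin 3))) = 0 := by
      funext s y; simp [stPull]
    rw [hvisc, hforce, hpre1] at h0
    exact h0
  -- the zoomed classical gradient
  have hGu : HasWeakSpatialGradientOn PO u fun t x => fderiv ℝ (u t) x :=
    hasWeakSpatialGradientOn_of_contDiffOn isOpen_Ioo hPOslab
      ((SereginSverak2002.classical_Ioo hsol).smooth_velocity.of_le (by norm_cast))
  have hGv : HasWeakSpatialGradientOn (parabolicCylinderOpens 1 (0 : ℝ × EuclideanSpace ℝ (Fin 3)))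
      (α • stPull β R T x₀ u) ((α * R) • stPull β R T x₀ fun t x => fderiv ℝ (u t) x) := by
    rw [← hpre1]
    exact hGu.stRescale α hβpos hRpos T x₀
  -- the class `IsSuitableWeakSolutionInBall 1 0`
  have hball : IsSuitableWeakSolutionInBall 1 0 (α • stPull β R T x₀ u)
      (α ^ 2 • stPull β R T x₀ q) := by
    refine ⟨hsuit1, ?_, ⟨_, hGv, ?_⟩, ?_⟩
    · -- energy class
      set CE : ENNReal := ENNReal.ofReal (2 * VectorCalculus.kineticEnergy (u 0)) with hCE
      have hphys : ∀ᵐ t ∂(volume.restrict (Ioo (T + β * (-1)) (T + β * 0))),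
          ∫⁻ x in ball x₀ R, ‖u t x‖ₑ ^ 2 ≤ CE := by
        refine (ae_restrict_mem measurableSet_Ioo).mono fun t ht => ?_
        have htI : t ∈ Icc 0 T :=
          ⟨by nlinarith [ht.1], by have := ht.2; simp at this; exact this.le⟩
        exact (setLIntegral_le_lintegral _ _).trans (SereginSverak2002.eEnergy_le hν.le hLH htI)
      have h2 := ae_sliced_setLIntegral_ball_stRescale hβpos hRpos T x₀ x₀ R (-1) 0
        (fun t x => ‖u t x‖ₑ ^ 2) hphys
      rw [finrank_euclideanSpace_fin, sub_self, smul_zero, div_self hRpos.ne'] at h2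
      set C₁ : ENNReal := ‖α‖ₑ ^ 2 * (ENNReal.ofReal (R ^ 3)⁻¹ * CE) with hC₁
      have hC₁top : C₁ ≠ ⊤ :=
        ENNReal.mul_ne_top (by simp) (ENNReal.mul_ne_top ENNReal.ofReal_ne_top ENNReal.ofReal_ne_top)
      refine ⟨C₁.toNNReal, ?_⟩
      rw [ENNReal.coe_toNNReal hC₁top]
      have hset : Ioo ((0 : ℝ × EuclideanSpace ℝ (Fin 3)).1 - 1 ^ 2)
          (0 : ℝ × EuclideanSpace ℝ (Fin 3)).1 = Ioo (-1 : ℝ) 0 := by simp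
      rw [hset]
      filter_upwards [h2] with s hs
      have e : ∀ y : EuclideanSpace ℝ (Fin 3), ‖(α • stPull β R T x₀ u) s y‖ₑ ^ 2 =
          ‖α‖ₑ ^ 2 * ‖u (T + β * s) (x₀ + R • y)‖ₑ ^ 2 := by
        intro y
        rw [smul_stPull_apply, enorm_smul, mul_pow]
      simp only [e]
      rw [lintegral_const_mul' _ _ (by simp)]
      exact mul_le_mul' le_rfl hs
    · -- `∫_{Q(0,1)} |∇v|² < ⊤`
      have hpre : parabolicCylinder 1 (0 : ℝ × EuclideanSpace ℝ (Fin 3)) =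
          stAffine β R T x₀ ⁻¹' (Ioo (T - (R * 1) ^ 2 / ν) T ×ˢ ball x₀ (R * 1)) := by
        rw [hβdef, stAffine_preimage_cylinder_eq_parabolicCylinder hν hRpos T x₀ (R * 1),
          mul_div_cancel_left₀ (1 : ℝ) hRpos.ne']
        rfl
      rw [hpre, setLIntegral_frobeniusNormSq_stRescale hβpos hRpos T x₀ (α * R),
        finrank_euclideanSpace_fin]
      refine ENNReal.mul_lt_top (ENNReal.mul_lt_top ENNReal.ofReal_lt_top ENNReal.ofReal_lt_top) ?_
      refine lt_of_le_of_lt (lintegral_mono_set ?_)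
        (SereginSverak2002.lintegral_slab_frobeniusNormSq_fderiv_lt_top' hsol hLH)
      rw [mul_one]
      rintro ⟨t, x⟩ ⟨ht, -⟩
      refine ⟨⟨?_, ht.2⟩, mem_univ _⟩
      have : R ^ 2 / ν = β := rfl
      linarith [ht.1]
    · -- `π ∈ L^{3/2}(Q(0,1))`
      refine ⟨hsuit1.distributional.2.2.1.aestronglyMeasurable, ?_⟩
      have h32 : ((3 : ENNReal) / 2).toReal = 3 / 2 := by rw [ENNReal.toReal_div]; norm_num
      have h32top : (3 : ENNReal) / 2 ≠ ⊤ := (ENNReal.div_lt_top (by simp) (by simp)).ne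
      rw [eLpNorm_eq_lintegral_rpow_enorm_toReal (by norm_num) h32top, h32]
      refine ENNReal.rpow_lt_top_of_nonneg (by positivity) (ne_of_lt ?_)
      have hQ1 : parabolicCylinder 1 (0 : ℝ × EuclideanSpace ℝ (Fin 3)) =
          stAffine β R T x₀ ⁻¹' (PO : Set (ℝ × EuclideanSpace ℝ (Fin 3))) := by
        rw [← coe_stPreimage, hpre1]; rfl
      rw [hQ1]
      show ∫⁻ z in stAffine β R T x₀ ⁻¹' (PO : Set (ℝ × EuclideanSpace ℝ (Fin 3))),
          ‖(α ^ 2 • stPull β R T x₀ q) z.1 z.2‖ₑ ^ (3 / 2 : ℝ) < ⊤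
      rw [setLIntegral_enorm_rpow_stRescale hβpos hRpos T x₀ (α ^ 2) q _ (by norm_num)]
      refine ENNReal.mul_lt_top (ENNReal.mul_lt_top
        (ENNReal.rpow_lt_top_of_nonneg (by norm_num) enorm_ne_top) ENNReal.ofReal_lt_top) ?_
      exact lt_of_le_of_lt (lintegral_mono_set hPOslab)
        (SereginSverak2002.lintegral_slab_gauged_pressure_lt_top hν hT hsol hLH)
  -- the scaled energies `A` on every parabolic sub-ball of `Q(0,1)`
  set Abd : ENNReal := ‖α‖ₑ ^ 2 * (ENNReal.ofReal (R ^ 3)⁻¹ * ENNReal.ofReal (M * R)) with hAbd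
  have hAbdtop : Abd < ⊤ := ENNReal.mul_lt_top (by simp)
    (ENNReal.mul_lt_top ENNReal.ofReal_lt_top ENNReal.ofReal_lt_top)
  have hA : ∀ (r : ℝ), 0 < r → ∀ (z : ℝ × EuclideanSpace ℝ (Fin 3)),
      parabolicCylinder r z ⊆ parabolicCylinder 1 (0 : ℝ × EuclideanSpace ℝ (Fin 3)) →
      cknAEss r z (α • stPull β R T x₀ u) ≤ Abd := by
    intro r hr z hz
    obtain ⟨-, -, ht1, ht2, -⟩ := parabolicCylinder_subset_data hr hz
    simp only [Prod.fst_zero, one_pow, zero_sub] at ht1 ht2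
    have hr1 : r ≤ 1 := by nlinarith
    have hRr : R * r ≤ r₀ := by nlinarith
    have hlow : -β ≤ β * (z.1 - r ^ 2) := by nlinarith
    have hsubT : Ioo (T + β * (z.1 - r ^ 2)) (T + β * z.1) ⊆ Ioo (T - δ) T := by
      intro t ht
      constructor
      · linarith [ht.1]
      · nlinarith [ht.2]
    have hphys : ∀ᵐ t ∂(volume.restrict (Ioo (T + β * (z.1 - r ^ 2)) (T + β * z.1))),
        ∫⁻ x in ball (x₀ + R • z.2) (R * r), ‖u t x‖ₑ ^ 2 ≤ ENNReal.ofReal (M * (R * r)) := by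
      refine (ae_restrict_mem measurableSet_Ioo).mono fun t ht => ?_
      have htw : t ∈ Ioo (T - δ) T := hsubT ht
      have htI : t ∈ Icc 0 T := ⟨by linarith [htw.1], htw.2.le⟩
      have hb := hM t htw (x₀ + R • z.2) (R * r) (by positivity) hRr
      have hint : IntegrableOn (fun x => ‖u t x‖ ^ 2) (ball (x₀ + R • z.2) (R * r)) :=
        ((hLH.memLp t htI).integrable_norm_pow two_ne_zero).integrableOn
      have e : ∫⁻ x in ball (x₀ + R • z.2) (R * r), ‖u t x‖ₑ ^ 2 =
          ENNReal.ofReal (∫ x in ball (x₀ + R • z.2) (R * r), ‖u t x‖ ^ 2) := by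
        rw [ofReal_integral_eq_lintegral_ofReal hint (Eventually.of_forall fun x => by positivity)]
        refine lintegral_congr fun x => ?_
        rw [← ofReal_norm, ENNReal.ofReal_pow (norm_nonneg _)]
      rw [e]
      exact ENNReal.ofReal_le_ofReal hb
    have h2 := ae_sliced_setLIntegral_ball_stRescale hβpos hRpos T x₀ (x₀ + R • z.2) (R * r)
      (z.1 - r ^ 2) z.1 (fun t x => ‖u t x‖ₑ ^ 2) hphys
    rw [finrank_euclideanSpace_fin, add_sub_cancel_left, smul_smul, inv_mul_cancel₀ hRpos.ne',
      one_smul, mul_div_cancel_left₀ r hRpos.ne'] at h2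
    refine essSup_le_of_ae_le _ ?_
    filter_upwards [h2] with s hs
    have e : ∀ y : EuclideanSpace ℝ (Fin 3), ‖(α • stPull β R T x₀ u) s y‖ₑ ^ 2 =
        ‖α‖ₑ ^ 2 * ‖u (T + β * s) (x₀ + R • y)‖ₑ ^ 2 := by
      intro y
      rw [smul_stPull_apply, enorm_smul, mul_pow]
    simp only [e]
    rw [lintegral_const_mul' _ _ (by simp)]
    have hr0 : ENNReal.ofReal r ≠ 0 := (ENNReal.ofReal_pos.2 hr).ne'
    calc (ENNReal.ofReal r)⁻¹ * (‖α‖ₑ ^ 2 *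
          ∫⁻ y in ball z.2 r, ‖u (T + β * s) (x₀ + R • y)‖ₑ ^ 2)
        ≤ (ENNReal.ofReal r)⁻¹ * (‖α‖ₑ ^ 2 *
            (ENNReal.ofReal (R ^ 3)⁻¹ * ENNReal.ofReal (M * (R * r)))) :=
          mul_le_mul' le_rfl (mul_le_mul' le_rfl hs)
      _ = Abd := by
          rw [hAbd, show M * (R * r) = (M * R) * r by ring,
            ENNReal.ofReal_mul (by positivity : (0:ℝ) ≤ M * R)]
          rw [show (ENNReal.ofReal r)⁻¹ * (‖α‖ₑ ^ 2 * (ENNReal.ofReal (R ^ 3)⁻¹ *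
              (ENNReal.ofReal (M * R) * ENNReal.ofReal r))) =
              ‖α‖ₑ ^ 2 * (ENNReal.ofReal (R ^ 3)⁻¹ * ENNReal.ofReal (M * R)) *
                ((ENNReal.ofReal r)⁻¹ * ENNReal.ofReal r) by ring,
            ENNReal.inv_mul_cancel hr0 ENNReal.ofReal_ne_top, mul_one]
  have hAsup : (⨆ (r : ℝ) (_ : 0 < r) (z' : ℝ × EuclideanSpace ℝ (Fin 3))
      (_ : parabolicCylinder r z' ⊆ parabolicCylinder 1 (0 : ℝ × EuclideanSpace ℝ (Fin 3))),
        cknAEss r z' (α • stPull β R T x₀ u)) < ⊤ := by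
    refine lt_of_le_of_lt ?_ hAbdtop
    exact iSup_le fun r => iSup_le fun hr => iSup_le fun z' => iSup_le fun hz' => hA r hr z' hz'
  exact ⟨hball, hGv, albrittonBarker2019_lemma_2_6_holds 0 _ _ hball _ hGv (Or.inl hAsup) (1 / 2)
    (by norm_num) (by norm_num)⟩

/-- **No local Type I singular point ⇒ backward boundedness at every final-time point, under a
Morrey bound.** If no suitable weak solution of the unforced unit-viscosity system has a Type I
singular point in the sense of Albritton–Barker 2019, Thm. 1.1 (`¬ LocalTypeISingularityExists`,
the registered OPEN statement of `LocalTypeI.lean` — false under the Liouville conjecture (L)),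
then a classical Leray–Hopf solution on `[0, T)` with the Morrey bound of
`exists_zoom_typeIBound_lt_top_of_morrey` is bounded on a backward cylinder at every `(T, x₀)`:
otherwise the origin would be a local Type I singular point of its zoom (the argument of the tree's
`seregin_sverak_2002_of_not_localTypeISingularityExists`).
[cite: AlbrittonBarker2019, Thm. 1.1 and Lemma 2.6] -/
theorem isBackwardBoundedAt_of_morrey_of_not_localTypeISingularityExists
    (hno : ¬ LocalTypeISingularityExists) (hν : 0 < ν) (hT : 0 < T)
    (hsol : IsClassicalNSSolutionOn (Ico 0 T) ν 0 u p) (hLH : IsLerayHopfOn T ν 0 (u 0) u)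
    {r₀ M₀ T₁ : ℝ} (hr₀ : 0 < r₀) (hT₁ : T₁ < T)
    (hMor : ∀ t ∈ Ioo T₁ T, ∀ (x₁ : EuclideanSpace ℝ (Fin 3)) (r : ℝ), 0 < r → r ≤ r₀ →
      ∫ x in ball x₁ r, ‖u t x‖ ^ 2 ≤ M₀ * r)
    (x₀ : EuclideanSpace ℝ (Fin 3)) : IsBackwardBoundedAt u T x₀ := by
  obtain ⟨R, α, β, hR, hα, hβ, -, -, hβT, hball, hGv, htypeI⟩ :=
    exists_zoom_typeIBound_lt_top_of_morrey hν hT hsol hLH hr₀ hT₁ hMor x₀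
  by_contra hnot
  apply hno
  have hsing : IsBackwardSingularPoint (α • stPull β R T x₀ u) (0 : ℝ × EuclideanSpace ℝ (Fin 3)) := by
    intro r hr
    by_contra hfin
    have hfin' : eLpNorm (uncurry (α • stPull β R T x₀ u)) ⊤
        (volume.restrict (parabolicCylinder (min r 1) (0 : ℝ × EuclideanSpace ℝ (Fin 3)))) < ⊤ := by
      refine lt_of_le_of_lt (eLpNorm_mono_measure _ (Measure.restrict_mono ?_ le_rfl))
        (lt_top_iff_ne_top.2 hfin)
      exact SuitableCompactness.parabolicCylinder_zero_mono (le_min hr.le zero_le_one) (min_le_left _ _)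
    exact hnot (SereginSverak2002.isBackwardBoundedAt_of_zoom hsol x₀ hR hα hβ hβT (lt_min hr one_pos)
      (min_le_right _ _) hfin')
  refine ⟨1 / 2, 0, α • stPull β R T x₀ u,
    α ^ 2 • stPull β R T x₀ (fun t x => p t x - (p t 0 - normalisedPressure (u t) 0)),
    by norm_num, ?_, hsing, _,
    hGv.mono (SuitableCompactness.parabolicCylinderOpens_zero_mono (by norm_num) (by norm_num)),
    htypeI⟩
  exact SuitableCompactness.isSuitableWeakSolutionInBall_of_le_radius hball (by norm_num) (by norm_num)

end Zoom

/-- **The Morrey bound from the route's `ScaledEnergyBound` (item stmt-NavierStokesRegularity-2884)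
and the Type I rate.** For a classical Leray–Hopf solution from a rapidly decaying datum with
`IsTypeIBlowup u T` (`‖u(t, x)‖ ≤ C'/√(T − t)` eventually), the eventual dimensionless rate
`√(T − t)‖u(t, x)‖ ≤ C√ν` holds with `C = max (C'/√ν) 1 > 0` (as in the ladder glue
`LadderGlue`), so `ScaledEnergyBound` yields `r₀ > 0`, `T₁ < T` and a constant `M = A ν²` with
`∫_{B(x₁, r)} |u(t)|² ≤ M r` for `T₁ < t < T`, all `x₁` and `0 < r ≤ r₀`. Pure bookkeeping.
[cite: BarkerPrange2020, (e.typeI)] -/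
theorem eventually_morrey_of_scaledEnergyBound
    (h84 : Summit.NavierStokesRegularity.NavierStokesRegularity.Theses.TypeICertificateLadder.ScaledEnergyBound)
    {ν T : ℝ} (hν : 0 < ν) (hT : 0 < T)
    {u : ℝ → EuclideanSpace ℝ (Fin 3) → EuclideanSpace ℝ (Fin 3)} {p : ℝ → EuclideanSpace ℝ (Fin 3) → ℝ}
    (hsol : IsClassicalNSSolutionOn (Ico 0 T) ν 0 u p) (hLH : IsLerayHopfOn T ν 0 (u 0) u)
    (hdec : HasRapidSpatialDecay (u 0)) (hI : IsTypeIBlowup u T) :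
    ∃ r₀ M₀ T₁ : ℝ, 0 < r₀ ∧ T₁ < T ∧
      ∀ t ∈ Ioo T₁ T, ∀ (x₁ : EuclideanSpace ℝ (Fin 3)) (r : ℝ), 0 < r → r ≤ r₀ →
        ∫ x in ball x₁ r, ‖u t x‖ ^ 2 ≤ M₀ * r := by
  -- the eventual dimensionless rate with a positive constant
  obtain ⟨C', hC'⟩ := hI
  have hsν : 0 < Real.sqrt ν := Real.sqrt_pos.2 hν
  set C : ℝ := max (C' / Real.sqrt ν) 1 with hC
  have hCpos : 0 < C := lt_of_lt_of_le one_pos (le_max_right _ _)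
  have hrate : ∀ᶠ t in 𝓝[<] T, ∀ x, Real.sqrt (T - t) * ‖u t x‖ ≤ C * Real.sqrt ν := by
    filter_upwards [hC', self_mem_nhdsWithin] with t ht htT x
    have htT' : t < T := htT
    have hpos : 0 < Real.sqrt (T - t) := Real.sqrt_pos.2 (sub_pos.2 htT')
    have h1 : ‖u t x‖ ≤ C' / Real.sqrt (T - t) := ht x
    calc Real.sqrt (T - t) * ‖u t x‖ ≤ Real.sqrt (T - t) * (C' / Real.sqrt (T - t)) :=
          mul_le_mul_of_nonneg_left h1 hpos.le
      _ = C' := mul_div_cancel₀ C' hpos.ne'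
      _ = C' / Real.sqrt ν * Real.sqrt ν := (div_mul_cancel₀ C' hsν.ne').symm
      _ ≤ C * Real.sqrt ν := mul_le_mul_of_nonneg_right (le_max_left _ _) hsν.le
  obtain ⟨A, hA⟩ := h84 C hCpos
  obtain ⟨r₀, hr₀, hev⟩ := hA ν T hν hT u p hsol hLH hdec hrate
  obtain ⟨T₁, hT₁T, hT₁⟩ := mem_nhdsLT_iff_exists_Ioo_subset.1 hev
  refine ⟨r₀, A * ν ^ 2, T₁, hr₀, hT₁T, fun t ht x₁ r hr hrr₀ => ?_⟩
  have h1 : r⁻¹ * (∫ x in ball x₁ r, ‖u t x‖ ^ 2) ≤ A * ν ^ 2 := hT₁ ht x₁ r hr hrr₀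
  rw [inv_mul_le_iff₀ hr] at h1
  linarith

/-- **`NoTypeIBlowup` (item stmt-NavierStokesRegularity-1217) from `ScaledEnergyBound`
(item stmt-NavierStokesRegularity-2884) and the non-existence of local Type I singular points
(`¬ LocalTypeISingularityExists`, Albritton–Barker 2019, Thm. 1.1, first bullet — a registered
OPEN statement; false under the Liouville conjecture (L) of KNSS 2009 via `AlbrittonBarkerForward`
and `LiouvilleConjectureNS.not_nontrivialMildAncientTypeIExists_measurable`).** A classical
Leray–Hopf solution from a rapidly decaying datum with the Type I rate has the Morrey bound near `T`
(`eventually_morrey_of_scaledEnergyBound`), hence is bounded on a backward cylinder at every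
`(T, x₀)` (`isBackwardBoundedAt_of_morrey_of_not_localTypeISingularityExists`), hence extends past
`T` by Lemarié-Rieusset 2016, Thm. 15.1 (C) (`hasSmoothExtensionPast_of_forall_exists_parabolicCylinder`).
CONDITIONAL on both hypotheses; it does not close the item.
[cite: AlbrittonBarker2019, Thm. 1.1; LemarieRieusset2016, Thm 15.1 (C)] -/
theorem noTypeIBlowup_of_scaledEnergyBound_of_not_localTypeISingularityExists
    (h84 : Summit.NavierStokesRegularity.NavierStokesRegularity.Theses.TypeICertificateLadder.ScaledEnergyBound)
    (hno : ¬ LocalTypeISingularityExists) :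
    Summit.NavierStokesRegularity.NavierStokesRegularity.Theses.TypeICertificateLadder.NoTypeIBlowup := by
  unfold Summit.NavierStokesRegularity.NavierStokesRegularity.Theses.TypeICertificateLadder.NoTypeIBlowup
  intro ν T hν hT u p hsol hLH hdec hI
  obtain ⟨r₀, M₀, T₁, hr₀, hT₁, hMor⟩ := eventually_morrey_of_scaledEnergyBound h84 hν hT hsol hLH hdec hI
  refine hasSmoothExtensionPast_of_forall_exists_parabolicCylinder hν hT hsol hLH hdec fun x₀ => ?_
  obtain ⟨r, hr, K, hK⟩ :=
    isBackwardBoundedAt_of_morrey_of_not_localTypeISingularityExists hno hν hT hsol hLH hr₀ hT₁ hMor x₀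
  refine ⟨r, hr, ?_⟩
  rw [eLpNorm_exponent_top]
  refine eLpNormEssSup_lt_top_of_ae_bound (C := K) ?_
  refine (ae_restrict_mem ?_).mono ?_
  · exact measurableSet_Ioo.prod measurableSet_ball
  · rintro ⟨t, x⟩ hz
    rw [mem_parabolicCylinder] at hz
    exact hK t hz.1 x hz.2

end Summit.NavierStokesRegularity.NavierStokesRegularity.Theorems

end
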